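/-
Copyright (c) 2026. Released under Apache 2.0 license.
-/
import Literature.NumberTheory.Automorphic.IncompleteEisensteinPlancherel
import HarnessLib

/-!
# The Eisenstein subspace `𝓔₀(Γ\ℍ) ⊂ L²(𝒟)` for `SL₂(ℤ)`: isometry, projection and density

Source: H. Iwaniec, *Spectral Methods of Automorphic Forms*, 2nd ed., AMS GSM 53 (2002), §3.2
(incomplete Eisenstein series, Lemma 3.3 = (3.14)–(3.15)), §3.4 ((3.26): the residual spectrum of
the modular group is the constant `u₀ = (3/π)^{1/2}`), §7.1 (Proposition 7.1: the Eisenstein transform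
is an isometry on `𝓔(Γ\ℍ) ∩` smooth) and Theorem 7.3 ((7.15)).

For `Γ = SL₂(ℤ)` and `H = L²(𝒟)` (`𝒟` the standard fundamental domain, `dμ = y⁻² dx dy`) we set up

* `oneLp` — the constant function (the residual spectrum), `⟨1, f⟩ = ∫_𝒟 f`, `‖1‖² = π/3`;
* `eisSubspace = (ℂ·1 ⊔ 𝓒)^⊥` — the **Eisenstein subspace** `𝓔₀`, the orthogonal complement of
  the constants and of the cusp forms `𝓒 = cuspSubmodule` (`CuspFormsCompact.lean`);
* `EisCombo` — finite combinations `β = Σ cᵢ E(·|ψᵢ)` of incomplete Eisenstein series with smooth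
  non-negative weights, their `L²` classes `β.lp`, Eisenstein coefficients `β.coeff = ℰβ` and
  masses `β.mass = ∫_𝒟 β`;

and prove

* `EisCombo.inner_lp_lp` — **the isometry identity** (Theorem 7.3 paired with a second combination,
  from `integral_fd_incEisG_mul_incEisG_eq_spectral`):
  `⟨β₁, β₂⟩ = (3/π) conj(∫β₁)(∫β₂) + (1/4π) ∫ conj ℰβ₁ · ℰβ₂`;
* `EisCombo.starProjection_lp`, `EisCombo.inner_starProjection_lp` — `Pβ = β - (3/π)(∫β)·1` and
  **Plancherel on `P𝓔`**: `⟨Pβ₁, Pβ₂⟩ = (1/4π) ∫ conj ℰβ₁ · ℰβ₂` (Proposition 7.1 for the span of the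
  incomplete Eisenstein series);
* `mem_cuspSubmodule_of_forall_integral_eq_zero` — **`𝓔^⊥ ⊆ 𝓒`** ((3.15)): an `L²` function whose
  constant term integrates to zero against every `y⁻²ψ(y) dy` (`ψ ≥ 0` a smooth bump) is cuspidal —
  the measure theory (measurability of the automorphic extension, the constant term as a measurable
  locally integrable function of the height, signed test functions as differences of non-negative
  bumps, null heights are null in `ℍ`) is carried out in full;
* `eq_zero_of_mem_eisSubspace_of_forall_inner_starProjection_eq_zero` — **density**: an element of
  `𝓔₀` orthogonal to all `P E(·|ψ)` vanishes.

These are the Hilbert-space inputs for the Eisenstein wave packets, Bessel's inequality and the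
pretrace formula (Theorem 7.4) for `SL₂(ℤ)` in the sequel.
-/

noncomputable section

open MeasureTheory Set Filter Real UpperHalfPlane
open scoped Topology MatrixGroups ComplexConjugate NNReal ENNReal Modular


namespace Literature.NumberTheory.Automorphic

open MeasureTheory Set Filter Real Complex InnerProductSpace
open scoped Topology ComplexConjugate ENNReal Modular MatrixGroups

local notation "Γℤ" => (𝒮ℒ : Subgroup (GL (Fin 2) ℝ))
local notation "μ𝒟" => MeasureTheory.Measure.restrict (volume : Measure ℍ) (ModularGroup.fd)
local notation "H𝒟" => MeasureTheory.Lp ℂ 2 (MeasureTheory.Measure.restrict (volume : Measure ℍ) (ModularGroup.fd))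

attribute [local instance] isFiniteMeasure_restrict_fd

section Setup

/-- **The constant function `1 ∈ L²(𝒟)`** (the residual spectrum of `SL₂(ℤ)`: `u₀ = 1/‖1‖ = (3/π)^{½}`,
(3.26)). [cite: Iwaniec2002, (3.26) & §7.1, PDF pp. 47, 97] -/
def oneLp : H𝒟 := (memLp_const (1 : ℂ)).toLp _

/-- `1` is represented by the constant function. [folklore] -/
theorem oneLp_coeFn : ⇑oneLp =ᵐ[μ𝒟] fun _ => (1 : ℂ) := MemLp.coeFn_toLp _

/-- `⟨1, f⟩ = ∫_𝒟 f`. [folklore] -/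
theorem inner_oneLp_left (f : H𝒟) : ⟪oneLp, f⟫_ℂ = ∫ w in ModularGroup.fd, f w := by
  rw [L2.inner_def]
  refine integral_congr_ae ?_
  filter_upwards [oneLp_coeFn] with w hw
  rw [hw]; simp

/-- `‖1‖² = vol(𝒟) = π/3`. [cite: Iwaniec2002, (3.26), PDF p. 47] -/
theorem inner_oneLp_self : ⟪oneLp, oneLp⟫_ℂ = ((π / 3 : ℝ) : ℂ) := by
  rw [inner_oneLp_left]
  have := integral_congr_ae (μ := μ𝒟) oneLp_coeFn
  rw [this, integral_fd_one]

/-- `⟨f, 1⟩ = conj ∫_𝒟 f`. [folklore] -/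
theorem inner_oneLp_right (f : H𝒟) : ⟪f, oneLp⟫_ℂ = conj (∫ w in ModularGroup.fd, f w) := by
  rw [← inner_conj_symm, inner_oneLp_left]

/-- **The Eisenstein subspace** `𝓔₀(Γ\ℍ) = (ℂ·1 ⊕ 𝓒(Γ\ℍ))^⊥ ⊂ L²(𝒟)`: the orthogonal complement
of the residual spectrum (the constants, (3.26)) and the cusp forms; by Theorem 7.3 it is the space
`𝓔_∞(Γ\ℍ)` of the Eisenstein transform. [cite: Iwaniec2002, §7.1 & Thm 7.3, PDF pp. 97-100] -/
def eisSubspace : Submodule ℂ H𝒟 := ((ℂ ∙ oneLp) ⊔ cuspSubmodule)ᗮ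

/-- `𝓔₀` is complete (closed in `L²(𝒟)`). [folklore] -/
instance : CompleteSpace eisSubspace := (Submodule.isClosed_orthogonal _).completeSpace_coe

/-- Membership: `f ∈ 𝓔₀ ↔ ⟨1, f⟩ = 0 ∧ f ⊥ 𝓒`. [folklore] -/
theorem mem_eisSubspace_iff (f : H𝒟) :
    f ∈ eisSubspace ↔ ⟪oneLp, f⟫_ℂ = 0 ∧ ∀ x ∈ cuspSubmodule, ⟪x, f⟫_ℂ = 0 := by
  unfold eisSubspace
  rw [Submodule.mem_orthogonal]
  constructor
  · intro h
    exact ⟨h _ (Submodule.mem_sup_left (Submodule.mem_span_singleton_self _)),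
      fun x hx => h _ (Submodule.mem_sup_right hx)⟩
  · rintro ⟨h1, h2⟩ u hu
    obtain ⟨y, hy, z, hz, rfl⟩ := Submodule.mem_sup.mp hu
    obtain ⟨a, rfl⟩ := Submodule.mem_span_singleton.mp hy
    rw [inner_add_left, inner_smul_left, h1, h2 z hz, mul_zero, add_zero]

/-- `1 ∈ 𝓔₀^⊥`. [folklore] -/
theorem oneLp_mem_eisSubspace_orthogonal : oneLp ∈ eisSubspaceᗮ :=
  Submodule.le_orthogonal_orthogonal _ (Submodule.mem_sup_left (Submodule.mem_span_singleton_self _))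

/-- `𝓒 ≤ 𝓔₀^⊥`. [folklore] -/
theorem cuspSubmodule_le_eisSubspace_orthogonal : cuspSubmodule ≤ eisSubspaceᗮ := fun _ hx =>
  Submodule.le_orthogonal_orthogonal _ (Submodule.mem_sup_right hx)

/-- An inner product against a Hilbert-basis vector of `𝓒` through representatives. [folklore] -/
theorem inner_eq_setIntegral {x g : H𝒟} {u g' : ℍ → ℂ} (hux : u =ᵐ[μ𝒟] x) (hg : ⇑g =ᵐ[μ𝒟] g') :
    ⟪x, g⟫_ℂ = ∫ w in ModularGroup.fd, conj (u w) * g' w := by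
  rw [L2.inner_def]
  refine integral_congr_ae ?_
  filter_upwards [hux, hg] with w hu hg'
  rw [← hu, hg']; simp [mul_comm]

/-- **Orthogonality to `𝓒` is tested on the Maass cusp forms of a Hilbert basis**: if
`⟨x, g⟩ = 0` for the basis vectors `x`, then `⟨y, g⟩ = 0` for all `y ∈ 𝓒`. [folklore] -/
theorem inner_eq_zero_of_forall_basis {s : Set cuspSubmodule} (b : HilbertBasis s ℂ cuspSubmodule)
    (hb : ⇑b = ((↑) : s → cuspSubmodule)) (g : H𝒟)
    (h : ∀ x ∈ s, ⟪((x : cuspSubmodule) : H𝒟), g⟫_ℂ = 0) :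
    ∀ y ∈ cuspSubmodule, ⟪y, g⟫_ℂ = 0 := by
  set φ : cuspSubmodule →L[ℂ] ℂ := (innerSL ℂ g).comp cuspSubmodule.subtypeL with hφ
  have hφ0 : ∀ y : cuspSubmodule, φ y = 0 := by
    have hspan : Submodule.span ℂ (Set.range b) ≤ LinearMap.ker φ.toLinearMap := by
      rw [Submodule.span_le]
      rintro _ ⟨i, rfl⟩
      simp only [SetLike.mem_coe, LinearMap.mem_ker, ContinuousLinearMap.coe_coe, hφ,
        ContinuousLinearMap.coe_comp, Function.comp_apply, Submodule.subtypeL_apply, innerSL_apply_apply]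
      rw [hb, ← inner_conj_symm, h i i.2, map_zero]
    have hcl : (Submodule.span ℂ (Set.range b)).topologicalClosure ≤ LinearMap.ker φ.toLinearMap :=
      Submodule.topologicalClosure_minimal _ hspan (φ.isClosed_ker)
    rw [b.dense_span] at hcl
    intro y
    exact hcl Submodule.mem_top
  intro y hy
  have := hφ0 ⟨y, hy⟩
  simp only [hφ, ContinuousLinearMap.coe_comp, Function.comp_apply, Submodule.subtypeL_apply, innerSL_apply_apply] at this
  rw [← inner_conj_symm, this, map_zero]

/-- A representative of a basis vector is square-integrable on `𝒟`. [folklore] -/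
theorem integrableOn_norm_sq_of_ae_eq {u : ℍ → ℂ} (x : H𝒟) (hux : u =ᵐ[μ𝒟] x) :
    IntegrableOn (fun z => ‖u z‖ ^ 2) ModularGroup.fd := by
  have h := (Lp.memLp x).ae_eq hux.symm
  exact (memLp_two_iff_integrable_sq_norm h.1).mp h

/-- `⟨u, 1⟩ = 0` for every Maass cusp form (zero or not). [cite: Iwaniec2002, §3.3-3.4 & (3.26), PDF pp. 44-47] -/
theorem IsMaassCuspForm.setIntegral_fd_eq_zero' {u : ℍ → ℂ} {t : ℂ} (h : IsMaassCuspForm u t)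
    (hL2 : IntegrableOn (fun z => ‖u z‖ ^ 2) ModularGroup.fd) : ∫ z in ModularGroup.fd, u z = 0 := by
  by_cases hne : ∃ z, u z ≠ 0
  · obtain ⟨μ, _, _, ht⟩ := h.eigenvalue_ge hL2 hne
    exact h.setIntegral_fd_eq_zero hL2 ht
  · push Not at hne
    simp [hne]

/-- `⟨u, E(·, ½+ir)⟩ = 0` for every Maass cusp form and every `r ≠ 0`. [cite: Iwaniec2002, Thm 6.7 & §7.1, PDF pp. 92, 97] -/
theorem IsMaassCuspForm.integral_fd_conj_mul_eisensteinCrit' {u : ℍ → ℂ} {t : ℂ} (h : IsMaassCuspForm u t)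
    (hL2 : IntegrableOn (fun z => ‖u z‖ ^ 2) ModularGroup.fd) {r : ℝ} (hr : r ≠ 0) :
    ∫ z in ModularGroup.fd, conj (u z) * eisensteinCrit z r = 0 := by
  by_cases hne : ∃ z, u z ≠ 0
  · obtain ⟨μ, _, _, ht⟩ := h.eigenvalue_ge hL2 hne
    exact h.integral_fd_conj_mul_eisensteinCrit hL2 ht hr
  · push Not at hne
    simp [hne]

/-- **Cusp forms are orthogonal to the constants**: `⟨1, x⟩ = 0` for `x ∈ 𝓒`. [cite: Iwaniec2002, §3.4 & (3.26), PDF p. 47] -/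
theorem inner_oneLp_eq_zero_of_mem_cuspSubmodule {x : H𝒟} (hx : x ∈ cuspSubmodule) : ⟪oneLp, x⟫_ℂ = 0 := by
  obtain ⟨s, b, _, hb, hforms⟩ := exists_hilbertBasis_maassCuspForms
  have h := inner_eq_zero_of_forall_basis b hb oneLp (fun y hy => ?_) x hx
  · rw [← inner_conj_symm, h, map_zero]
  · obtain ⟨u, t, hu, hux, _⟩ := hforms y hy
    rw [inner_eq_setIntegral hux oneLp_coeFn]
    simp only [mul_one]
    rw [integral_conj, hu.setIntegral_fd_eq_zero' (integrableOn_norm_sq_of_ae_eq _ hux), map_zero]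

/-- `𝓒 ⊥ 1`, the other order. [folklore] -/
theorem inner_oneLp_eq_zero_of_mem_cuspSubmodule' {x : H𝒟} (hx : x ∈ cuspSubmodule) : ⟪x, oneLp⟫_ℂ = 0 := by
  rw [← inner_conj_symm, inner_oneLp_eq_zero_of_mem_cuspSubmodule hx, map_zero]

variable {ψ : ℝ → ℝ}

/-- **Incomplete Eisenstein series are orthogonal to `𝓒`** (in `L²(𝒟)`). [cite: Iwaniec2002, (3.14)-(3.15) & §7.1, PDF pp. 44, 97] -/
theorem inner_incEisLp_eq_zero_of_mem_cuspSubmodule (hψ : IsBumpWeight ψ) {x : H𝒟} (hx : x ∈ cuspSubmodule) :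
    ⟪x, incEisLp hψ⟫_ℂ = 0 := by
  obtain ⟨s, b, _, hb, hforms⟩ := exists_hilbertBasis_maassCuspForms
  refine inner_eq_zero_of_forall_basis b hb _ (fun y hy => ?_) x hx
  obtain ⟨u, t, hu, hux, _⟩ := hforms y hy
  rw [inner_eq_setIntegral hux (incEisLp_coeFn hψ)]
  exact hu.integral_fd_conj_mul_incEisG hψ

/-- `⟨1, E(·|ψ)⟩ = 2∫ψy⁻² = 2Mψ(-1)`. [cite: Iwaniec2002, Lemma 3.3 (3.14), PDF p. 44] -/
theorem inner_oneLp_incEisLp (hψ : IsBumpWeight ψ) :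
    ⟪oneLp, incEisLp hψ⟫_ℂ = 2 * mellin (cplx ψ) (-1) := by
  rw [inner_oneLp_left, integral_congr_ae (incEisLp_coeFn hψ), integral_fd_incEisG hψ,
    show (-1 : ℂ) = 0 - 1 by ring, show cplx ψ = fun v => ((ψ v : ℝ) : ℂ) from rfl, ← integral_inv_sq_mul_cpow ψ 0]
  congr 1
  refine setIntegral_congr_fun measurableSet_Ioi fun y hy => ?_
  have hy' : (0 : ℝ) < y := hy
  rw [Complex.cpow_zero, mul_one]

/-- `Mψ(-1)` is real. [folklore] -/
theorem conj_mellin_neg_one (ψ : ℝ → ℝ) : conj (mellin (cplx ψ) (-1)) = mellin (cplx ψ) (-1) := by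
  rw [← mellin_cplx_conj]; simp

end Setup

/-! ## Finite combinations of incomplete Eisenstein series and the isometry identity -/

section Combo

variable {ψ ψ₁ ψ₂ : ℝ → ℝ}

/-- **The inner product of two incomplete Eisenstein series in spectral form** (from the Plancherel
formula of `IncompleteEisensteinPlancherel.lean`):
`⟨E(·|ψ₁), E(·|ψ₂)⟩ = 4(3/π)Mψ₁(-1)Mψ₂(-1) + (1/4π)∫ conj ℰ_{ψ₁} · ℰ_{ψ₂}`. [cite: Iwaniec2002, Thm 7.3 (7.15), PDF p. 100] -/
theorem inner_incEisLp_incEisLp (h₁ : IsSmoothBump ψ₁) (h₂ : IsSmoothBump ψ₂) (h₂0 : ∀ t, 0 ≤ ψ₂ t) :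
    ⟪incEisLp h₁.isBumpWeight, incEisLp h₂.isBumpWeight⟫_ℂ =
      4 * (3 / π * (mellin (cplx ψ₁) (-1) * mellin (cplx ψ₂) (-1))) +
        ((1 / (4 * π) : ℝ) : ℂ) * ∫ r : ℝ, conj (eisCoeff ψ₁ r) * eisCoeff ψ₂ r := by
  rw [inner_eq_setIntegral (incEisLp_coeFn h₁.isBumpWeight).symm (incEisLp_coeFn h₂.isBumpWeight)]
  simp only [Complex.conj_ofReal]
  have h := integral_fd_incEisG_mul_incEisG_eq_spectral h₂ h₂0 h₁
  have e1 : ∫ w in ModularGroup.fd, ((incEisG ψ₁ w : ℝ) : ℂ) * ((incEisG ψ₂ w : ℝ) : ℂ) =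
      ∫ w in ModularGroup.fd, ((incEisG ψ₂ w : ℝ) : ℂ) * ((incEisG ψ₁ w : ℝ) : ℂ) := by
    congr 1; funext w; ring
  have e2 : ∫ r : ℝ, conj (eisCoeff ψ₁ r) * eisCoeff ψ₂ r = ∫ r : ℝ, eisCoeff ψ₂ r * conj (eisCoeff ψ₁ r) := by
    congr 1; funext r; ring
  rw [e1, h, e2]
  ring

/-- The coefficient function of an `L²` finite sum of scaled classes. [folklore] -/
theorem coeFn_sum_smul {ι : Type*} (s : Finset ι) (c : ι → ℂ) (f : ι → H𝒟) (g : ι → ℍ → ℂ)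
    (hfg : ∀ i ∈ s, ⇑(f i) =ᵐ[μ𝒟] g i) :
    ⇑(∑ i ∈ s, c i • f i) =ᵐ[μ𝒟] fun w => ∑ i ∈ s, c i * g i w := by
  classical
  induction s using Finset.induction_on with
  | empty =>
    simp only [Finset.sum_empty]
    exact Lp.coeFn_zero ℂ 2 _
  | insert a s ha ih =>
    rw [Finset.sum_insert ha]
    have h1 := Lp.coeFn_add (c a • f a) (∑ i ∈ s, c i • f i)
    have h2 := Lp.coeFn_smul (c a) (f a)
    filter_upwards [h1, h2, ih (fun i hi => hfg i (Finset.mem_insert_of_mem hi)), hfg a (Finset.mem_insert_self a s)]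
      with w hw1 hw2 hw3 hw4
    rw [hw1, Pi.add_apply, hw2, Pi.smul_apply, hw3, hw4, Finset.sum_insert ha, smul_eq_mul]

/-- **A finite linear combination `β = Σ c_i E(·|ψ_i)` of incomplete Eisenstein series** with smooth
non-negative weights — the elements of Iwaniec's `𝓔(Γ\ℍ)` used here (these combinations already
span the incomplete Eisenstein series of all real smooth weights). [cite: Iwaniec2002, §3.2 & §7.1, PDF pp. 43, 97] -/
structure EisCombo where
  /-- number of terms -/
  n : ℕ
  /-- the weights -/
  ψ : Fin n → ℝ → ℝ
  smooth : ∀ i, IsSmoothBump (ψ i)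
  nonneg : ∀ i t, 0 ≤ ψ i t
  /-- the coefficients -/
  c : Fin n → ℂ

namespace EisCombo

variable (β β₁ β₂ : EisCombo)

/-- The weights are bump weights. [folklore] -/
theorem bw (i : Fin β.n) : IsBumpWeight (β.ψ i) := (β.smooth i).isBumpWeight

/-- `β` as a function on `ℍ`. [folklore] -/
def fn : ℍ → ℂ := fun w => ∑ i, β.c i * ((incEisG (β.ψ i) w : ℝ) : ℂ)

/-- `β` in `L²(𝒟)`. [folklore] -/
def lp : H𝒟 := ∑ i, β.c i • incEisLp (β.bw i)

/-- The Eisenstein coefficient `ℰβ(r) = Σ c_i ℰ_{ψ_i}(r) = ∫_𝒟 β conj E(·, ½+ir)`. [cite: Iwaniec2002, (7.15), PDF p. 100] -/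
def coeff : ℝ → ℂ := fun r => ∑ i, β.c i * eisCoeff (β.ψ i) r

/-- The mass `∫_𝒟 β = Σ c_i · 2Mψ_i(-1) = ⟨1, β⟩`. [folklore] -/
def mass : ℂ := ∑ i, β.c i * (2 * mellin (cplx (β.ψ i)) (-1))

/-- `β` is represented by `fn`. [folklore] -/
theorem lp_coeFn : ⇑β.lp =ᵐ[μ𝒟] β.fn :=
  coeFn_sum_smul _ _ _ _ fun i _ => incEisLp_coeFn (β.bw i)

/-- `β.fn` is continuous. [folklore] -/
theorem continuous_fn : Continuous β.fn :=
  continuous_finsetSum _ fun i _ => continuous_const.mul (Complex.continuous_ofReal.comp (β.bw i).continuous_incEisG)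

/-- `β.fn` is bounded. [folklore] -/
theorem exists_bound_fn : ∃ C : ℝ, ∀ w, ‖β.fn w‖ ≤ C := by
  have h : ∀ i : Fin β.n, ∃ C : ℝ, ∀ w, ‖β.c i * ((incEisG (β.ψ i) w : ℝ) : ℂ)‖ ≤ C := by
    intro i
    obtain ⟨C, _, hC⟩ := (β.bw i).exists_bound
    refine ⟨‖β.c i‖ * C, fun w => ?_⟩
    rw [norm_mul, Complex.norm_real, Real.norm_eq_abs]
    exact mul_le_mul_of_nonneg_left (hC w) (norm_nonneg _)
  choose C hC using h
  refine ⟨∑ i, C i, fun w => (norm_sum_le _ _).trans (Finset.sum_le_sum fun i _ => hC i w)⟩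

/-- `β.fn` vanishes high in the cusp: `β.fn(w) = 0` for `Im w > Y(β)`. [folklore] -/
theorem exists_fn_eq_zero : ∃ Y : ℝ, ∀ w : ℍ, Y < w.im → β.fn w = 0 := by
  have h : ∀ i : Fin β.n, ∃ Y : ℝ, ∀ w : ℍ, Y < w.im → incEisG (β.ψ i) w = 0 := by
    intro i
    obtain ⟨a, b, ha, hsupp⟩ := (β.bw i).support
    exact ⟨max b a⁻¹, fun w hw => incEisG_eq_zero_of_im_gt ha hsupp hw⟩
  choose Y hY using h
  refine ⟨∑ i, |Y i|, fun w hw => Finset.sum_eq_zero fun i _ => ?_⟩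
  rw [hY i w ((le_abs_self _).trans_lt (lt_of_le_of_lt (Finset.single_le_sum (fun j _ => abs_nonneg (Y j))
    (Finset.mem_univ i)) hw)), Complex.ofReal_zero, mul_zero]

/-- `β` is automorphic. [folklore] -/
theorem isAutomorphic_fn : IsAutomorphic Γℤ β.fn := by
  intro γ hγ z
  unfold fn
  refine Finset.sum_congr rfl fun i _ => ?_
  have := isAutomorphic_incEisG (β.ψ i) γ hγ z
  simp only at this
  rw [this]

/-- `⟨1, β⟩ = mass`. [folklore] -/
theorem inner_oneLp_lp : ⟪oneLp, β.lp⟫_ℂ = β.mass := by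
  unfold lp mass
  rw [inner_sum]
  refine Finset.sum_congr rfl fun i _ => ?_
  rw [inner_smul_right, inner_oneLp_incEisLp]

/-- `∫_𝒟 β = mass`. [folklore] -/
theorem integral_fd_fn : ∫ w in ModularGroup.fd, β.fn w = β.mass := by
  rw [← inner_oneLp_lp, inner_oneLp_left]
  exact (integral_congr_ae β.lp_coeFn).symm

/-- `β ⊥ 𝓒`. [cite: Iwaniec2002, (3.15) & §7.1, PDF pp. 44, 97] -/
theorem inner_eq_zero_of_mem_cuspSubmodule {x : H𝒟} (hx : x ∈ cuspSubmodule) : ⟪x, β.lp⟫_ℂ = 0 := by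
  unfold lp
  rw [inner_sum]
  refine Finset.sum_eq_zero fun i _ => ?_
  rw [inner_smul_right, inner_incEisLp_eq_zero_of_mem_cuspSubmodule (β.bw i) hx, mul_zero]

/-- `ℰβ` is continuous. [folklore] -/
theorem continuous_coeff : Continuous β.coeff :=
  continuous_finsetSum _ fun i _ => continuous_const.mul (continuous_eisCoeff (β.bw i))

/-- `conj ℰ_{ψ_i} · ℰ_{ψ'_j}` is integrable. [folklore] -/
theorem integrable_conj_eisCoeff_mul (h₁ : IsSmoothBump ψ₁) (h₂ : IsSmoothBump ψ₂) :
    Integrable fun r : ℝ => conj (eisCoeff ψ₁ r) * eisCoeff ψ₂ r :=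
  (integrable_eisCoeff_mul_conj h₂ h₁).congr (Eventually.of_forall fun r => by simp [mul_comm])

/-- **The isometry identity on `𝓔(Γ\ℍ)`** (Theorem 7.3 paired with a second combination):
`⟨β₁, β₂⟩ = (3/π) conj(∫β₁)(∫β₂) + (1/4π)∫ conj ℰβ₁ · ℰβ₂`. [cite: Iwaniec2002, Thm 7.3 (7.15) & Prop 7.1, PDF pp. 97-100] -/
theorem inner_lp_lp : ⟪β₁.lp, β₂.lp⟫_ℂ = ((3 / π : ℝ) : ℂ) * (conj β₁.mass * β₂.mass) +
    ((1 / (4 * π) : ℝ) : ℂ) * ∫ r : ℝ, conj (β₁.coeff r) * β₂.coeff r := by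
  -- expand everything into double sums over `(i, j)`
  have hL : ⟪β₁.lp, β₂.lp⟫_ℂ = ∑ i, ∑ j, conj (β₁.c i) * β₂.c j *
      (4 * (3 / π * (mellin (cplx (β₁.ψ i)) (-1) * mellin (cplx (β₂.ψ j)) (-1))) +
        ((1 / (4 * π) : ℝ) : ℂ) * ∫ r : ℝ, conj (eisCoeff (β₁.ψ i) r) * eisCoeff (β₂.ψ j) r) := by
    unfold lp
    rw [sum_inner]
    refine Finset.sum_congr rfl fun i _ => ?_
    rw [inner_sum]
    refine Finset.sum_congr rfl fun j _ => ?_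
    rw [inner_smul_left, inner_smul_right, inner_incEisLp_incEisLp (β₁.smooth i) (β₂.smooth j) (β₂.nonneg j)]
    ring
  have hM : ((3 / π : ℝ) : ℂ) * (conj β₁.mass * β₂.mass) = ∑ i, ∑ j, conj (β₁.c i) * β₂.c j *
      (4 * (3 / π * (mellin (cplx (β₁.ψ i)) (-1) * mellin (cplx (β₂.ψ j)) (-1)))) := by
    unfold mass
    rw [map_sum, Finset.sum_mul, Finset.mul_sum]
    refine Finset.sum_congr rfl fun i _ => ?_
    rw [Finset.mul_sum, Finset.mul_sum]
    refine Finset.sum_congr rfl fun j _ => ?_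
    simp only [map_mul, conj_mellin_neg_one, map_ofNat]
    push_cast
    ring
  have hint : ∀ i j, Integrable fun r : ℝ => conj (β₁.c i) * β₂.c j * (conj (eisCoeff (β₁.ψ i) r) * eisCoeff (β₂.ψ j) r) :=
    fun i j => (integrable_conj_eisCoeff_mul (β₁.smooth i) (β₂.smooth j)).const_mul _
  have hI : ((1 / (4 * π) : ℝ) : ℂ) * ∫ r : ℝ, conj (β₁.coeff r) * β₂.coeff r = ∑ i, ∑ j, conj (β₁.c i) * β₂.c j *
      (((1 / (4 * π) : ℝ) : ℂ) * ∫ r : ℝ, conj (eisCoeff (β₁.ψ i) r) * eisCoeff (β₂.ψ j) r) := by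
    have e : ∀ r : ℝ, conj (β₁.coeff r) * β₂.coeff r =
        ∑ i, ∑ j, conj (β₁.c i) * β₂.c j * (conj (eisCoeff (β₁.ψ i) r) * eisCoeff (β₂.ψ j) r) := by
      intro r
      unfold coeff
      rw [map_sum, Finset.sum_mul_sum]
      refine Finset.sum_congr rfl fun i _ => Finset.sum_congr rfl fun j _ => ?_
      rw [map_mul]; ring
    simp_rw [e]
    rw [integral_finsetSum _ (fun i _ => integrable_finsetSum _ fun j _ => hint i j), Finset.mul_sum]
    refine Finset.sum_congr rfl fun i _ => ?_
    rw [integral_finsetSum _ (fun j _ => hint i j), Finset.mul_sum]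
    refine Finset.sum_congr rfl fun j _ => ?_
    rw [integral_const_mul]
    ring
  rw [hL, hM, hI, ← Finset.sum_add_distrib]
  refine Finset.sum_congr rfl fun i _ => ?_
  rw [← Finset.sum_add_distrib]
  refine Finset.sum_congr rfl fun j _ => ?_
  ring

/-- **The projection of `β` onto `𝓔₀`**: `Pβ = β - (3/π)(∫β)·1` (`β ⊥ 𝓒`, so only the constant is
removed; `‖1‖² = π/3`). [cite: Iwaniec2002, Thm 7.3 & (3.26), PDF pp. 47, 100] -/
theorem starProjection_lp : eisSubspace.starProjection β.lp = β.lp - ((((3 / π : ℝ) : ℂ)) * β.mass) • oneLp := by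
  have hπ : (π : ℂ) ≠ 0 := by exact_mod_cast Real.pi_pos.ne'
  refine Submodule.eq_starProjection_of_mem_orthogonal' (z := ((((3 / π : ℝ) : ℂ)) * β.mass) • oneLp) ?_ ?_ (by abel)
  · rw [mem_eisSubspace_iff]
    constructor
    · rw [inner_sub_right, inner_smul_right, inner_oneLp_lp, inner_oneLp_self]
      push_cast
      field_simp
      ring
    · intro x hx
      rw [inner_sub_right, inner_smul_right, β.inner_eq_zero_of_mem_cuspSubmodule hx,
        inner_oneLp_eq_zero_of_mem_cuspSubmodule' hx, mul_zero, sub_zero]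
  · exact Submodule.smul_mem _ _ oneLp_mem_eisSubspace_orthogonal

/-- **Plancherel on `𝓔(Γ\ℍ)` for the Eisenstein transform** (Iwaniec, Theorem 7.3 / Proposition 7.1
for `SL₂(ℤ)`): `⟨Pβ₁, Pβ₂⟩ = (1/4π) ∫ conj ℰβ₁ · ℰβ₂` — the map `Pβ ↦ ℰβ` is an isometry from
`P(𝓔) ⊆ 𝓔₀` into `L²(ℝ, dr/4π)`. [cite: Iwaniec2002, Prop 7.1 (7.7) & Thm 7.3 (7.15), PDF pp. 97-100] -/
theorem inner_starProjection_lp : ⟪eisSubspace.starProjection β₁.lp, eisSubspace.starProjection β₂.lp⟫_ℂ =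
    ((1 / (4 * π) : ℝ) : ℂ) * ∫ r : ℝ, conj (β₁.coeff r) * β₂.coeff r := by
  have hπ : (π : ℂ) ≠ 0 := by exact_mod_cast Real.pi_pos.ne'
  rw [starProjection_lp, starProjection_lp, inner_sub_left, inner_sub_right, inner_sub_right, inner_smul_left,
    inner_smul_left, inner_smul_right, inner_smul_right, inner_lp_lp, inner_oneLp_lp, inner_oneLp_self,
    ← inner_conj_symm β₁.lp oneLp, inner_oneLp_lp]
  simp only [map_mul, Complex.conj_ofReal]
  push_cast
  field_simp
  ring

/-- In particular `‖Pβ‖² = (1/4π)∫|ℰβ|²`. [cite: Iwaniec2002, Prop 7.1 Cor., PDF p. 97] -/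
theorem norm_sq_starProjection_lp : ‖eisSubspace.starProjection β.lp‖ ^ 2 = 1 / (4 * π) * ∫ r : ℝ, ‖β.coeff r‖ ^ 2 := by
  have h := β.inner_starProjection_lp β
  have e : ∫ r : ℝ, conj (β.coeff r) * β.coeff r = ((∫ r : ℝ, ‖β.coeff r‖ ^ 2 : ℝ) : ℂ) := by
    rw [← integral_complex_ofReal]
    congr 1; funext r
    rw [Complex.conj_mul', ← Complex.ofReal_pow]
  rw [e, ← Complex.ofReal_mul] at h
  rw [@norm_sq_eq_re_inner ℂ, h]
  exact Complex.ofReal_re _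

end EisCombo

end Combo

/-! ## `𝓔(Γ\ℍ)^⊥ ⊆ 𝓒(Γ\ℍ)` (Iwaniec (3.15)): density of the projected incomplete Eisenstein series in `𝓔₀` -/

section Density

open EisensteinSeries ModularGroup

/-- For each `z`, only finitely many `γ ∈ SL₂(ℤ)` move `z` into the fundamental domain `𝒟`
(discreteness: `Im(γz) = y_Γ(z)` and `|Re γz| ≤ ½` pin `γz` in a compact set). [cite: Iwaniec2002, §2.1-2.2, PDF pp. 27-29] -/
theorem finite_smul_mem_fd (z : ℍ) : {γ : GL (Fin 2) ℝ | γ ∈ Γℤ ∧ γ • z ∈ ModularGroup.fd}.Finite := by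
  set Y := orbitHeight z with hY
  have hY0 : 0 < Y := orbitHeight_pos z
  -- all such `γ z` lie in the compact box `|Re| ≤ 1/2`, `Im = Y`
  set B : Set ℍ := {w : ℍ | w.re ∈ Icc (-(1 / 2) : ℝ) (1 / 2) ∧ w.im ∈ Icc Y Y} with hB
  have hBc : IsCompact B := isCompact_box hY0
  obtain ⟨R, hR⟩ := (hBc.isBounded.subset_closedBall z) |> fun h => (Metric.isBounded_iff_subset_closedBall z).mp hBc.isBounded
  refine (finite_hypBall modular_le_range_toGL isDiscreteSubgroup_modular z z (Real.sinh (R / 2) ^ 2)).subset ?_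
  rintro γ ⟨hγ, hγz⟩
  refine ⟨hγ, pointPairInv_le_of_dist_le ?_⟩
  obtain ⟨g, rfl⟩ := hγ
  have e : (Matrix.SpecialLinearGroup.mapGL ℝ g : GL (Fin 2) ℝ) • z = g • z := rfl
  rw [e] at hγz ⊢
  have hmem : g • z ∈ B := by
    refine ⟨⟨by linarith [(abs_le.mp hγz.2).1], by linarith [(abs_le.mp hγz.2).2]⟩, ?_⟩
    have : (g • z).im = Y := by rw [hY, ← orbitHeight_smul g z, orbitHeight_eq_im_of_mem_fd hγz]
    exact ⟨this.ge, this.le⟩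
  exact Metric.mem_closedBall.mp (hR hmem)

/-- **The automorphic extension of a measurable function is measurable** (a pointwise finite sum). [folklore] -/
theorem measurable_autExt {g : ℍ → ℂ} (hg : Measurable g) : Measurable (autExt Γℤ ModularGroup.fd g) := by
  haveI : Countable Γℤ := isDiscreteSubgroup_modular.countable.to_subtype
  classical
  set f : Γℤ → ℍ → ℂ := fun γ w => (ModularGroup.fd).indicator g ((γ : GL (Fin 2) ℝ) • w) with hf
  have hfm : ∀ γ, Measurable (f γ) := fun γ =>
    (hg.indicator isHypFundamentalDomain_modular_fd.measurableSet).comp (continuous_const_smul (γ : GL (Fin 2) ℝ)).measurable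
  have hsum : ∀ w, Summable fun γ => f γ w := by
    intro w
    refine summable_of_ne_finset_zero (s := ((finite_smul_mem_fd w).preimage Subtype.val_injective.injOn).toFinset) ?_
    intro γ hγ
    simp only [Set.Finite.mem_toFinset, Set.mem_preimage, Set.mem_setOf_eq, not_and] at hγ
    simp only [hf]
    rw [Set.indicator_of_notMem (hγ γ.2)]
  have hlim : Tendsto (fun s : Finset Γℤ => fun w => ∑ γ ∈ s, f γ w) atTop (𝓝 fun w => ∑' γ, f γ w) := by
    rw [tendsto_pi_nhds]
    exact fun w => (hsum w).hasSum
  have hmeas : Measurable fun w => ∑' γ, f γ w :=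
    measurable_of_tendsto_metrizable' atTop (fun s => Finset.measurable_sum s fun γ _ => hfm γ) hlim
  have e : autExt Γℤ ModularGroup.fd g = fun w => (1 / 2 : ℂ) * ∑' γ : Γℤ, f γ w := rfl
  rw [e]
  exact hmeas.const_mul _

/-- **Null sets of heights are null in `ℍ`**: `{w : Im w ∈ N}` has measure zero when `N` does.
[folklore] -/
theorem volume_setOf_im_mem_eq_zero {N : Set ℝ} (hNm : MeasurableSet N) (hN : volume N = 0) :
    volume {w : ℍ | w.im ∈ N} = 0 := by
  have hSm : MeasurableSet {w : ℍ | w.im ∈ N} := hNm.preimage UpperHalfPlane.continuous_im.measurable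
  have hmeas : Measurable fun w : ℍ => ({w : ℍ | w.im ∈ N}).indicator (1 : ℍ → ℝ≥0∞) w :=
    measurable_one.indicator hSm
  rw [← lintegral_indicator_one hSm, lintegral_upperHalfPlane_eq _ hmeas]
  have hC : volume {z : ℂ | z.im ∈ N} = 0 := by
    have e : {z : ℂ | z.im ∈ N} = Complex.measurableEquivRealProd ⁻¹' (univ ×ˢ N) := by
      ext z; simp [Complex.measurableEquivRealProd_apply]
    rw [e, Complex.volume_preserving_equiv_real_prod.measure_preimage (MeasurableSet.univ.prod hNm).nullMeasurableSet,
      Measure.volume_eq_prod, Measure.prod_prod, hN, mul_zero]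
  refine le_antisymm ?_ bot_le
  calc ∫⁻ z in {z : ℂ | 0 < z.im}, ENNReal.ofReal ((z.im ^ 2)⁻¹) * ({w : ℍ | w.im ∈ N}).indicator (1 : ℍ → ℝ≥0∞) (invCoe z)
      ≤ ∫⁻ z in {z : ℂ | 0 < z.im}, ({z : ℂ | z.im ∈ N}).indicator (fun z => ENNReal.ofReal ((z.im ^ 2)⁻¹)) z := by
        refine setLIntegral_mono' (measurableSet_lt measurable_const Complex.measurable_im) fun z hz => ?_
        have hz' : (0 : ℝ) < z.im := hz
        by_cases hN' : z.im ∈ N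
        · rw [Set.indicator_of_mem (s := {z : ℂ | z.im ∈ N}) hN']
          calc _ ≤ ENNReal.ofReal ((z.im ^ 2)⁻¹) * 1 := by
                gcongr
                by_cases h : invCoe z ∈ {w : ℍ | w.im ∈ N}
                · rw [Set.indicator_of_mem h]; exact le_rfl
                · rw [Set.indicator_of_notMem h]; exact zero_le_one
            _ = _ := mul_one _
        · have hinv : invCoe z ∉ {w : ℍ | w.im ∈ N} := by
            have e : invCoe z = pt z.re z.im := by
              rw [← invCoe_mk hz']
            rw [Set.mem_setOf_eq, e, pt_im hz']
            exact hN'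
          rw [Set.indicator_of_notMem hinv, Set.indicator_of_notMem (s := {z : ℂ | z.im ∈ N}) hN', mul_zero]
    _ ≤ ∫⁻ z, ({z : ℂ | z.im ∈ N}).indicator (fun z => ENNReal.ofReal ((z.im ^ 2)⁻¹)) z := setLIntegral_le_lintegral _ _
    _ = ∫⁻ z in {z : ℂ | z.im ∈ N}, ENNReal.ofReal ((z.im ^ 2)⁻¹) := lintegral_indicator (hNm.preimage Complex.measurable_im) _
    _ = 0 := setLIntegral_measure_zero _ _ hC

/-- **A signed smooth test function on `(0, ∞)` is a difference of two non-negative smooth bumps**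
(`g = (g + C χ) - C χ` with `χ` a bump equal to `1` on `supp g`, `C = sup|g|`). [folklore] -/
theorem exists_smoothBump_sub {g : ℝ → ℝ} (hg : ContDiff ℝ (⊤ : ℕ∞) g) (hgc : HasCompactSupport g)
    (hgU : tsupport g ⊆ Ioi 0) :
    ∃ ψ₁ ψ₂ : ℝ → ℝ, IsSmoothBump ψ₁ ∧ (∀ t, 0 ≤ ψ₁ t) ∧ IsSmoothBump ψ₂ ∧ (∀ t, 0 ≤ ψ₂ t) ∧ g = ψ₁ - ψ₂ := by
  by_cases hK : (tsupport g).Nonempty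
  swap
  · rw [Set.not_nonempty_iff_eq_empty] at hK
    have hg0 : g = 0 := by
      funext t
      by_contra h
      have : t ∈ tsupport g := subset_tsupport _ h
      rw [hK] at this; exact this
    refine ⟨0, 0, ⟨contDiff_const, 1, 1, one_pos, fun y hy => absurd rfl hy⟩, fun _ => le_rfl,
      ⟨contDiff_const, 1, 1, one_pos, fun y hy => absurd rfl hy⟩, fun _ => le_rfl, by rw [hg0, sub_zero]⟩
  have hKc : IsCompact (tsupport g) := hgc
  obtain ⟨a, haK, ha⟩ := hKc.exists_isMinOn hK continuousOn_id
  obtain ⟨b, hbK, hb⟩ := hKc.exists_isMaxOn hK continuousOn_id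
  have ha0 : 0 < a := hgU haK
  have hab : a ≤ b := ha hbK
  have hKab : tsupport g ⊆ Icc a b := fun y hy => ⟨ha hy, hb hy⟩
  obtain ⟨C, hC⟩ := hg.continuous.bounded_above_of_compact_support hgc
  have hC0 : 0 ≤ C := (norm_nonneg _).trans (hC a)
  -- the cutoff
  set c : ℝ := (a + b) / 2 with hc
  let χ : ContDiffBump c := ⟨(b - a) / 2 + a / 4, (b - a) / 2 + a / 2, by linarith, by linarith⟩
  have hrIn : χ.rIn = (b - a) / 2 + a / 4 := rfl
  have hrOut : χ.rOut = (b - a) / 2 + a / 2 := rfl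
  have hχ1 : ∀ y ∈ Icc a b, χ y = 1 := by
    intro y hy
    apply χ.one_of_mem_closedBall
    rw [Metric.mem_closedBall, Real.dist_eq, abs_le, hrIn]
    simp only [hc]
    constructor <;> linarith [hy.1, hy.2]
  have hχsupp : ∀ y, χ y ≠ 0 → a / 2 ≤ y ∧ y ≤ b + a / 2 := by
    intro y hy
    have : y ∈ Function.support (χ : ℝ → ℝ) := hy
    rw [χ.support_eq, Metric.mem_ball, Real.dist_eq, abs_lt, hrOut] at this
    simp only [hc] at this
    constructor <;> linarith [this.1, this.2]
  refine ⟨fun y => g y + C * χ y, fun y => C * χ y, ⟨hg.add (contDiff_const.mul χ.contDiff), a / 2, b + a / 2,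
    by positivity, fun y hy => ?_⟩, fun y => ?_, ⟨contDiff_const.mul χ.contDiff, a / 2, b + a / 2, by positivity,
    fun y hy => hχsupp y (fun h => hy (by rw [h, mul_zero]))⟩, fun y => mul_nonneg hC0 (χ.nonneg), by funext y; simp⟩
  · -- support of `g + Cχ`
    change g y + C * χ y ≠ 0 at hy
    by_cases hgy : g y = 0
    · rw [hgy, zero_add] at hy
      exact hχsupp y (fun h => hy (by rw [h, mul_zero]))
    · have := hKab (subset_tsupport _ hgy)
      exact ⟨by linarith [this.1], by linarith [this.2]⟩
  · -- non-negativity of `g + Cχ`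
    change 0 ≤ g y + C * χ y
    by_cases hy : y ∈ Icc a b
    · rw [hχ1 y hy, mul_one]
      have := hC y
      rw [Real.norm_eq_abs] at this
      linarith [neg_abs_le (g y)]
    · have hgy : g y = 0 := by
        by_contra h
        exact hy (hKab (subset_tsupport _ h))
      rw [hgy, zero_add]
      exact mul_nonneg hC0 χ.nonneg

/-- A compact subset of `(0, ∞)` lies in some `[a, b]` with `a > 0`. [folklore] -/
theorem exists_Icc_of_isCompact_subset_Ioi {k : Set ℝ} (hk : IsCompact k) (hk0 : k ⊆ Ioi 0) :
    ∃ a b : ℝ, 0 < a ∧ k ⊆ Icc a b := by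
  by_cases hne : k.Nonempty
  · obtain ⟨a, haK, ha⟩ := hk.exists_isMinOn hne continuousOn_id
    obtain ⟨b, hbK, hb⟩ := hk.exists_isMaxOn hne continuousOn_id
    exact ⟨a, b, hk0 haK, fun y hy => ⟨ha hy, hb hy⟩⟩
  · rw [Set.not_nonempty_iff_eq_empty] at hne
    exact ⟨1, 1, one_pos, by rw [hne]; exact Set.empty_subset _⟩

/-- `(1 : ℝ) +ᵥ (x + iy) = (x + 1) + iy`. [folklore] -/
theorem one_vadd_pt {y : ℝ} (hy : 0 < y) (t : ℝ) : ((1 : ℝ) +ᵥ pt t y : ℍ) = pt (t + 1) y := by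
  apply UpperHalfPlane.ext
  apply Complex.ext
  · simp [pt_re hy]; ring
  · simp [pt_im hy]

/-- `ξ +ᵥ w = (ξ + Re w) + i Im w`. [folklore] -/
theorem vadd_eq_pt (ξ : ℝ) (w : ℍ) : (ξ +ᵥ w : ℍ) = pt (ξ + w.re) w.im := by
  apply UpperHalfPlane.ext
  apply Complex.ext
  · simp [pt_re w.im_pos]
  · simp [pt_im w.im_pos]

/-- **`𝓔(Γ\ℍ)^⊥ ⊆ 𝓒(Γ\ℍ)` (Iwaniec (3.15)) in `L²(𝒟)`**: if the constant term of `x ∈ L²(𝒟)` integrates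
to zero against `y⁻²ψ(y)dy` for every non-negative smooth bump `ψ` (which is `⟨E(·|ψ), x⟩ = 0` by the
unfolding), then `x` is cuspidal. The measure theory: the cusp mean of the (measurable, exactly
automorphic) extension `x^Γ` is a measurable function of the height alone, locally integrable on
`(0, ∞)` by the strip disintegration, its integral against every signed smooth test function vanishes
(`g = ψ₁ - ψ₂`), so it vanishes for a.e. height, hence a.e. on `ℍ`. [cite: Iwaniec2002, Lemma 3.3 & (3.15), PDF p. 44] -/
theorem mem_cuspSubmodule_of_forall_integral_eq_zero (x : H𝒟)
    (h : ∀ ψ : ℝ → ℝ, IsSmoothBump ψ → (∀ t, 0 ≤ ψ t) →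
      ∫ y in Ioi (0 : ℝ), (((y ^ 2)⁻¹ * ψ y : ℝ) : ℂ) *
        ∫ t in Ico (0 : ℝ) 1, autExt Γℤ ModularGroup.fd x (pt t y) = 0) :
    x ∈ cuspSubmodule := by
  have hΓ := modular_le_range_toGL
  have hneg := neg_one_mem_modular
  have hd := isDiscreteSubgroup_modular
  have hF := isHypFundamentalDomain_modular_fd
  set G : ℍ → ℂ := autExt Γℤ ModularGroup.fd x with hG
  have hGm : Measurable G := measurable_autExt (Lp.stronglyMeasurable x).measurable
  have hGa : IsAutomorphic Γℤ G := isAutomorphic_autExt _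
  have hGl : LocallyIntegrable G := locallyIntegrable_autExt hΓ hneg hd hF (Lp.memLp x)
  -- the constant term as a measurable function of the height
  set Fp : ℝ × ℝ → ℂ := fun p => G (invCoe ⟨p.2, p.1⟩) with hFp
  have hmk : Measurable fun p : ℝ × ℝ => (⟨p.2, p.1⟩ : ℂ) := by
    have : (fun p : ℝ × ℝ => (⟨p.2, p.1⟩ : ℂ)) = fun p => Complex.equivRealProdCLM.symm (p.2, p.1) := by
      funext p; rfl
    rw [this]; fun_prop
  have hFpm : Measurable Fp := hGm.comp (measurable_invCoe.comp hmk)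
  set m : ℝ → ℂ := fun y => ∫ t in Ioc (0 : ℝ) 1, Fp (y, t) with hm
  have hmm : StronglyMeasurable m :=
    hFpm.stronglyMeasurable.integral_prod_right' (ν := volume.restrict (Ioc (0 : ℝ) 1))
  have hFp_eq : ∀ {y : ℝ}, 0 < y → ∀ t : ℝ, Fp (y, t) = G (pt t y) := by
    intro y hy t; simp only [hFp]; rw [invCoe_mk hy]
  have hm_eq : ∀ {y : ℝ}, 0 < y → m y = ∫ t in Ioc (0 : ℝ) 1, G (pt t y) := by
    intro y hy; simp only [hm]; exact setIntegral_congr_fun measurableSet_Ioc fun t _ => hFp_eq hy t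
  -- the cusp mean of `G` is `m ∘ Im`
  have hper : ∀ {y : ℝ}, 0 < y → Function.Periodic (fun t : ℝ => G (pt t y)) 1 := by
    intro y hy t
    simp only
    rw [← one_vadd_pt hy, hGa.vadd_one]
  have hM : ∀ w : ℍ, cuspMean G w = m w.im := by
    intro w
    have hy := w.im_pos
    rw [hm_eq hy, cuspMean, ← intervalIntegral.integral_of_le zero_le_one]
    have e1 : (fun ξ : ℝ => G (ξ +ᵥ w)) = fun ξ => (fun t => G (pt t w.im)) (ξ + w.re) := by
      funext ξ; rw [vadd_eq_pt]
    rw [e1, intervalIntegral.integral_comp_add_right (fun t => G (pt t w.im)), zero_add,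
      show (1 : ℝ) + w.re = w.re + 1 by ring, (hper hy).intervalIntegral_add_eq w.re 0, zero_add]
  -- local integrability of `f₀ = y⁻² m` on `(0, ∞)`
  set f₀ : ℝ → ℂ := fun y => (((y ^ 2)⁻¹ : ℝ) : ℂ) * m y with hf₀
  have hm_int : ∀ {a b : ℝ}, 0 < a → IntegrableOn m (Icc a b) := by
    intro a b ha
    -- strip disintegration of `‖G‖ₑ 𝟙_{a ≤ Im ≤ b}`
    set F₁ : ℍ → ℝ≥0∞ := fun w => ({w : ℍ | w.im ∈ Icc a b}).indicator (fun w => ‖G w‖ₑ) w with hF₁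
    have hF₁m : Measurable F₁ := hGm.enorm.indicator (measurableSet_Icc.preimage UpperHalfPlane.continuous_im.measurable)
    have hdis := setLIntegral_stripFD_eq F₁ hF₁m
    have hbox : IsCompact {w : ℍ | w.re ∈ Icc (0 : ℝ) 1 ∧ w.im ∈ Icc a b} := isCompact_box ha
    have hfin : ∫⁻ w in stripFD, F₁ w < ⊤ := by
      calc ∫⁻ w in stripFD, F₁ w ≤ ∫⁻ w in {w : ℍ | w.re ∈ Icc (0 : ℝ) 1 ∧ w.im ∈ Icc a b}, ‖G w‖ₑ := by
            rw [← lintegral_indicator measurableSet_stripFD, ← lintegral_indicator hbox.measurableSet]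
            refine lintegral_mono fun w => ?_
            simp only [hF₁, Set.indicator]
            split_ifs with h1 h2 h3
            · exact le_rfl
            · exact absurd ⟨⟨h1.1, h1.2.le⟩, h2⟩ h3
            · exact bot_le
            · exact le_rfl
            · exact bot_le
            · exact le_rfl
        _ < ⊤ := (hGl.integrableOn_isCompact hbox).2
    rw [hdis] at hfin
    -- the inner integrals for `y ∈ [a, b]`
    have hinner : ∀ y ∈ Icc a b, ∫⁻ t in Ico (0 : ℝ) 1, F₁ (pt t y) = ∫⁻ t in Ioc (0 : ℝ) 1, ‖G (pt t y)‖ₑ := by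
      intro y hy
      have hy0 : 0 < y := lt_of_lt_of_le ha hy.1
      rw [setLIntegral_congr Ico_ae_eq_Ioc]
      refine setLIntegral_congr_fun measurableSet_Ioc fun t _ => ?_
      simp only [hF₁]
      rw [Set.indicator_of_mem (show pt t y ∈ {w : ℍ | w.im ∈ Icc a b} by simp [pt_im hy0, hy.1, hy.2])]
    have hfin' : ∫⁻ y in Icc a b, (∫⁻ t in Ioc (0 : ℝ) 1, ‖G (pt t y)‖ₑ) * ENNReal.ofReal ((b ^ 2)⁻¹) < ⊤ := by
      refine lt_of_le_of_lt ?_ hfin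
      rw [← lintegral_indicator measurableSet_Icc, ← lintegral_indicator measurableSet_Ioi]
      refine lintegral_mono fun y => ?_
      by_cases hy : y ∈ Icc a b
      · have hy0 : 0 < y := lt_of_lt_of_le ha hy.1
        rw [Set.indicator_of_mem hy, Set.indicator_of_mem (show y ∈ Ioi (0 : ℝ) from hy0), hinner y hy]
        refine mul_le_mul_right (ENNReal.ofReal_le_ofReal ?_) _
        refine inv_anti₀ (by positivity) ?_
        gcongr
        exact hy.2
      · rw [Set.indicator_of_notMem hy]; exact bot_le
    rcases lt_or_ge b a with hba | hba
    · rw [Set.Icc_eq_empty (not_le.mpr hba)]; exact integrableOn_empty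
    have hb0 : 0 < b := lt_of_lt_of_le ha hba
    have hc : ENNReal.ofReal ((b ^ 2)⁻¹) ≠ 0 := by rw [ENNReal.ofReal_ne_zero_iff]; positivity
    rw [lintegral_mul_const' _ _ ENNReal.ofReal_ne_top] at hfin'
    have hfin'' : ∫⁻ y in Icc a b, ∫⁻ t in Ioc (0 : ℝ) 1, ‖G (pt t y)‖ₑ < ⊤ := by
      rcases ENNReal.mul_lt_top_iff.mp hfin' with h1 | h0 | h0
      · exact h1.1
      · rw [h0]; exact ENNReal.zero_lt_top
      · exact absurd h0 hc
    refine ⟨hmm.aestronglyMeasurable.restrict, ?_⟩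
    calc ∫⁻ y in Icc a b, ‖m y‖ₑ ≤ ∫⁻ y in Icc a b, ∫⁻ t in Ioc (0 : ℝ) 1, ‖G (pt t y)‖ₑ := by
          refine setLIntegral_mono' measurableSet_Icc fun y hy => ?_
          rw [hm_eq (lt_of_lt_of_le ha hy.1)]
          exact enorm_integral_le_lintegral_enorm _
      _ < ⊤ := hfin''
  have hf₀loc : LocallyIntegrableOn f₀ (Ioi 0) := by
    rw [locallyIntegrableOn_iff isOpen_Ioi.isLocallyClosed]
    intro k hk hkc
    obtain ⟨a, b, ha, hkab⟩ := exists_Icc_of_isCompact_subset_Ioi hkc hk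
    refine IntegrableOn.mono_set ?_ hkab
    refine IntegrableOn.continuousOn_mul ?_ (hm_int ha) isCompact_Icc
    intro y hy
    have hy0 : (0 : ℝ) < y := lt_of_lt_of_le ha hy.1
    exact (Complex.continuous_ofReal.continuousAt.comp ((continuousAt_id.pow 2).inv₀ (by simp [hy0.ne']))).continuousWithinAt
  -- Step (v): the hypothesis in terms of `f₀`
  have hv : ∀ ψ : ℝ → ℝ, IsSmoothBump ψ → (∀ t, 0 ≤ ψ t) → ∫ y in Ioi (0 : ℝ), ((ψ y : ℝ) : ℂ) * f₀ y = 0 := by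
    intro ψ hψ hψ0
    rw [← h ψ hψ hψ0]
    refine setIntegral_congr_fun measurableSet_Ioi fun y hy => ?_
    have hy' : (0 : ℝ) < y := hy
    simp only [hf₀]
    rw [hm_eq hy', ← integral_Ico_eq_integral_Ioc]
    push_cast; ring
  -- bumps times `f₀` are integrable
  have hbi : ∀ ψ : ℝ → ℝ, IsSmoothBump ψ → IntegrableOn (fun y => ((ψ y : ℝ) : ℂ) * f₀ y) (Ioi 0) := by
    intro ψ hψ
    obtain ⟨a, b, ha, hsupp⟩ := hψ.support
    have h1 : IntegrableOn (fun y => ((ψ y : ℝ) : ℂ) * f₀ y) (Icc a b) :=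
      IntegrableOn.continuousOn_mul (Complex.continuous_ofReal.comp hψ.smooth.continuous).continuousOn
        ((hf₀loc.integrableOn_compact_subset (fun y hy => lt_of_lt_of_le ha hy.1) isCompact_Icc)) isCompact_Icc
    refine h1.of_forall_sdiff_eq_zero measurableSet_Ioi fun y hy => ?_
    have : ψ y = 0 := by by_contra hne; exact hy.2 (hsupp y hne)
    simp [this]
  -- Step (vi): all signed smooth test functions
  have hvi : ∀ g : ℝ → ℝ, ContDiff ℝ (⊤ : ℕ∞) g → HasCompactSupport g → tsupport g ⊆ Ioi 0 →
      ∫ y, g y • f₀ y = 0 := by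
    intro g hg hgc hgU
    obtain ⟨ψ₁, ψ₂, h₁, h₁0, h₂, h₂0, hg12⟩ := exists_smoothBump_sub hg hgc hgU
    have e : ∀ y, g y • f₀ y = ((ψ₁ y : ℝ) : ℂ) * f₀ y - ((ψ₂ y : ℝ) : ℂ) * f₀ y := by
      intro y; rw [hg12, Pi.sub_apply, Complex.real_smul]; push_cast; ring
    simp_rw [e]
    rw [← setIntegral_eq_integral_of_forall_compl_eq_zero (s := Ioi 0) (fun y hy => ?_),
      integral_sub (hbi ψ₁ h₁) (hbi ψ₂ h₂), hv ψ₁ h₁ h₁0, hv ψ₂ h₂ h₂0, sub_zero]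
    obtain ⟨a₁, b₁, ha₁, hs₁⟩ := h₁.support
    obtain ⟨a₂, b₂, ha₂, hs₂⟩ := h₂.support
    have hy0 : y ≤ 0 := not_lt.mp hy
    have e1 : ψ₁ y = 0 := by by_contra hne; linarith [(hs₁ y hne).1]
    have e2 : ψ₂ y = 0 := by by_contra hne; linarith [(hs₂ y hne).1]
    simp [e1, e2]
  -- Step (vii): `m = 0` for a.e. height
  have hvii := isOpen_Ioi.ae_eq_zero_of_integral_contDiff_smul_eq_zero hf₀loc hvi
  have hm0 : ∀ᵐ y : ℝ, y ∈ Ioi (0 : ℝ) → m y = 0 := by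
    filter_upwards [hvii] with y hy hy0
    have := hy hy0
    simp only [hf₀, mul_eq_zero] at this
    rcases this with h0 | h0
    · exfalso
      have hy' : (0 : ℝ) < y := hy0
      have : ((y ^ 2)⁻¹ : ℝ) ≠ 0 := by positivity
      exact this (by exact_mod_cast h0)
    · exact h0
  -- Step (viii): lift to `ℍ`
  rw [mem_cuspSubmodule_iff]
  set N : Set ℝ := toMeasurable volume {y : ℝ | ¬(y ∈ Ioi (0 : ℝ) → m y = 0)} with hN
  have hN0 : volume N = 0 := by rw [hN, measure_toMeasurable]; exact ae_iff.mp hm0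
  have hNm : MeasurableSet N := measurableSet_toMeasurable _ _
  have hsub : {w : ℍ | cuspMean G w ≠ 0} ⊆ {w : ℍ | w.im ∈ N} := by
    intro w hw
    rw [Set.mem_setOf_eq, hM w] at hw
    exact subset_toMeasurable _ _ (fun himp => hw (himp w.im_pos))
  change cuspMean G =ᵐ[volume] 0
  rw [Filter.EventuallyEq, ae_iff]
  exact measure_mono_null (fun w hw => hsub (by simpa using hw)) (volume_setOf_im_mem_eq_zero hNm hN0)

variable {ψ : ℝ → ℝ}

/-- `⟨E(·|ψ), x⟩` through the constant term of `x^Γ`. [cite: Iwaniec2002, Lemma 3.3 (3.14), PDF p. 44] -/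
theorem inner_incEisLp_eq_integral (hψ : IsBumpWeight ψ) (x : H𝒟) :
    ⟪incEisLp hψ, x⟫_ℂ = 2 * ∫ y in Ioi (0 : ℝ), (((y ^ 2)⁻¹ * ψ y : ℝ) : ℂ) *
      ∫ t in Ico (0 : ℝ) 1, autExt Γℤ ModularGroup.fd x (pt t y) := by
  rw [← integral_fd_incEisG_mul_Lp hψ x, L2.inner_def]
  refine integral_congr_ae ?_
  filter_upwards [incEisLp_coeFn hψ] with w hw
  rw [hw]; simp [mul_comm]

/-- **Density**: an element of `𝓔₀` orthogonal to all `E(·|ψ)` (`ψ ≥ 0` smooth) vanishes — so the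
projections `P E(·|ψ)` span a dense subspace of `𝓔₀` ("`𝓡 ⊕ 𝓔_𝔞` densely fill `𝓔`", here `𝓡 = ℂ·1`).
[cite: Iwaniec2002, (3.15) & Thm 7.3, PDF pp. 44, 100] -/
theorem eq_zero_of_mem_eisSubspace_of_forall_inner_eq_zero {x : H𝒟} (hx : x ∈ eisSubspace)
    (h : ∀ ψ : ℝ → ℝ, ∀ hψ : IsSmoothBump ψ, (∀ t, 0 ≤ ψ t) → ⟪incEisLp hψ.isBumpWeight, x⟫_ℂ = 0) : x = 0 := by
  have hx𝓒 : x ∈ cuspSubmodule := by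
    refine mem_cuspSubmodule_of_forall_integral_eq_zero x fun ψ hψ hψ0 => ?_
    have := h ψ hψ hψ0
    rw [inner_incEisLp_eq_integral] at this
    exact (mul_eq_zero.mp this).resolve_left two_ne_zero
  have := ((mem_eisSubspace_iff x).mp hx).2 x hx𝓒
  exact inner_self_eq_zero.mp this

/-- The same with the projections `P E(·|ψ)` (`⟨Pβ, x⟩ = ⟨β, x⟩` for `x ∈ 𝓔₀`). [cite: Iwaniec2002, Thm 7.3, PDF p. 100] -/
theorem eq_zero_of_mem_eisSubspace_of_forall_inner_starProjection_eq_zero {x : H𝒟} (hx : x ∈ eisSubspace)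
    (h : ∀ ψ : ℝ → ℝ, ∀ hψ : IsSmoothBump ψ, (∀ t, 0 ≤ ψ t) →
      ⟪eisSubspace.starProjection (incEisLp hψ.isBumpWeight), x⟫_ℂ = 0) : x = 0 := by
  refine eq_zero_of_mem_eisSubspace_of_forall_inner_eq_zero hx fun ψ hψ hψ0 => ?_
  have := h ψ hψ hψ0
  rwa [Submodule.inner_starProjection_left_eq_right, (Submodule.starProjection_eq_self_iff).mpr hx] at this

end Density

end Literature.NumberTheory.Automorphic
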